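import Summits.Ventures.YMGap.Conjectures.TubeStringTension
import Summits.Ventures.YMGap.FlowData.TubeFluxNonAnnihilation
import HarnessLib

/-!
# Venture YMGap — the positivity conjunct of the tube string-tension law «L-Y3-σ» is a THEOREM: the typed
# conjectures reduce to the bare inequality `E₁ < L · (−ln u(β))` (theorems only; the conjecture text is untouched)

HONEST FRAMING: venture file of the cell `pub-ymgap` (QuantumFields programme), track Y3.  Companion THEOREMS about
the typed conjectures of `Conjectures/TubeStringTension.lean` (item (12), commit 840feeed49aa; text of record NOT
modified, R158): their first conjunct `0 < su2SectorTop β k L 0` («the flux sector is not annihilated, so that `E₁`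
is a genuine logarithm») is PROVED for every `β ≠ 0` by `FlowData/TubeFluxNonAnnihilation.lean`
(`su2_tubeSectorNorm_single_pos`: the Polyakov-line state lies in the sector and is not annihilated).  Hence
`TubeStringTensionLawDim3` and `TubeStringTensionLawDim4` are EQUIVALENT to the bare finite-volume inequalities
`E₁((ℤ/L)^k; β) < L · (−ln u(β))` (`k = 2, 3`), and the torelon energy in them is strictly positive.  Nothing here
decides the conjectures; finite spatial tori only; nothing about `L → ∞`, the continuum, a string tension or a mass
gap.  (The rectangular twin `TubeStringTensionLawDim3Rect` keeps its conjunct: its objects live on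
`RectSliceKernel`, whose non-annihilation theorem is not written.)

References: G. 't Hooft, Nucl. Phys. B 153 (1979) 141 [cite: tHooft1979Flux]; G. Münster, Nucl. Phys. B 180 (1981) 23
[folklore].
-/

noncomputable section

open Summit.Ventures.YMGap.FlowData

namespace Summit.Ventures.YMGap.Conjectures

/-- **The sector top is strictly positive**: `0 < su2SectorTop β k L μ = ‖T ∘ P_{ê_μ}‖` for every `β ≠ 0`, every
slice dimension `k`, side `L` and axis `μ`. [cite: tHooft1979Flux] -/
theorem su2SectorTop_pos {β : ℝ} (hβ : β ≠ 0) (k L : ℕ) [NeZero L] (μ : Fin k) : 0 < su2SectorTop β k L μ :=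
  su2_tubeSectorNorm_single_pos hβ k L μ

/-- **«L-Y3-σ» (d = 3) reduces to the bare inequality**: `TubeStringTensionLawDim3 ↔ ∀ L β > 0, E₁((ℤ/L)²; β) <
L · (−ln u(β))` — the positivity conjunct is a theorem. [folklore] -/
theorem tubeStringTensionLawDim3_iff_energy :
    TubeStringTensionLawDim3 ↔ ∀ (L : ℕ) [NeZero L] (β : ℝ), 0 < β →
      su2TorelonEnergy β 2 L 0 < (L : ℝ) * (-Real.log (su2CharacterRatio β)) :=
  ⟨fun h L _ β hβ => (h L β hβ).2, fun h L _ β hβ => ⟨su2SectorTop_pos hβ.ne' 2 L 0, h L β hβ⟩⟩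

/-- **«L-Y3-σ» (d = 4 twin) reduces to the bare inequality**: `TubeStringTensionLawDim4 ↔ ∀ L β > 0,
E₁((ℤ/L)³; β) < L · (−ln u(β))`. [folklore] -/
theorem tubeStringTensionLawDim4_iff_energy :
    TubeStringTensionLawDim4 ↔ ∀ (L : ℕ) [NeZero L] (β : ℝ), 0 < β →
      su2TorelonEnergy β 3 L 0 < (L : ℝ) * (-Real.log (su2CharacterRatio β)) :=
  ⟨fun h L _ β hβ => (h L β hβ).2, fun h L _ β hβ => ⟨su2SectorTop_pos hβ.ne' 3 L 0, h L β hβ⟩⟩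

/-- **Both sides of the law are positive**: for `β > 0` the torelon energy `E₁((ℤ/L)^k; β)` and the threshold
`L · (−ln u(β))` are strictly positive (`u(β) ∈ (0, 1)`: `u > 0` by Schwinger–Dyson, `u < 1` since `u = ⟨cos α⟩`
under a non-degenerate weight) — the law compares two positive numbers. [folklore] -/
theorem su2TorelonEnergy_pos_and_threshold_pos {β : ℝ} (hβ : 0 < β) (k L : ℕ) [NeZero L] (μ : Fin k) :
    0 < su2TorelonEnergy β k L μ ∧ 0 < (L : ℝ) * (-Real.log (su2CharacterRatio β)) := by
  refine ⟨su2TorelonEnergy_pos' hβ.ne' k L μ, mul_pos (Nat.cast_pos.2 (Nat.pos_of_ne_zero (NeZero.ne L))) ?_⟩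
  rw [neg_pos]
  refine Real.log_neg (su2CharacterRatio_pos hβ) ?_
  -- `u(β) = ⟨cos α⟩ < 1`: `∫ cos α · ω < ∫ ω` for the weight `ω = sin² α e^{β cos α} > 0` on `(0, π)`
  unfold su2CharacterRatio Summit.Ventures.LatticeQCDFlow.Scoring.onePlaquetteExpectSU2
  rw [div_lt_one (Summit.Ventures.LatticeQCDFlow.Scoring.onePlaquetteZSU2_pos β),
    Summit.Ventures.LatticeQCDFlow.Scoring.onePlaquetteZSU2]
  have hc : Continuous fun α => Real.cos α * (Real.sin α ^ 2 * Real.exp (β * Real.cos α)) := by fun_prop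
  have hw : Continuous fun α => Real.sin α ^ 2 * Real.exp (β * Real.cos α) := by fun_prop
  rw [← sub_pos, ← intervalIntegral.integral_sub (hw.intervalIntegrable _ _) (hc.intervalIntegrable _ _)]
  refine intervalIntegral.intervalIntegral_pos_of_pos_on ((hw.sub hc).intervalIntegrable _ _) (fun x hx => ?_)
    Real.pi_pos
  have hs : 0 < Real.sin x := Real.sin_pos_of_pos_of_lt_pi hx.1 hx.2
  have hcos : Real.cos x < 1 := by
    rw [← Real.cos_zero]
    exact Real.cos_lt_cos_of_nonneg_of_le_pi le_rfl hx.2.le hx.1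
  have hwx : 0 < Real.sin x ^ 2 * Real.exp (β * Real.cos x) := by positivity
  nlinarith

end Summit.Ventures.YMGap.Conjectures
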